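import Literature.AlgebraicGeometry.Frobenioids.DivisorialDescriptionsSectionsProofs
import Literature.AlgebraicGeometry.Frobenioids.DivisorialDescriptionsProofs
import Literature.AlgebraicGeometry.Frobenioids.FrTrFromThm51i
import HarnessLib

/-!
# Frobenioids I, Theorem 5.1 (iv): the three clauses CLOSED (abc-iut cell, layer L1, node `FrdI:Thm5.1(iv)`)

Mochizuki, *The geometry of Frobenioids I: the general theory*, Kyushu J. Math. **62** (2008)
293–400, §5, Theorem 5.1 (iv), kurims text p. 97 [cite: MochizukiFrdI2008, Thm. 5.1 (iv) p.97].
PROOF-ONLY link file: the conditional proofs of `DivisorialDescriptionsSectionsProofs.lean` (this seat,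
clauses 1 and 3 modulo the two "In particular" statements of Thm. 5.1 (iii)) composed with
`FrTrFromThm51i.lean` (seat abc-iut-found: those two statements from Thm. 5.1 (i)) and
`DivisorialDescriptionsProofs.lean` (seat abc-iut-L1-t10: `thm51i_holds`, Thm. 5.1 (i)). With the
unconditional `thm51iv_frobeniusSection` this kernel-closes every closed named statement of Thm. 5.1 (iv)
in `DivisorialDescriptionsSections.lean` (seat abc-iut-L1-t5). Nothing is defined here; no statement of
the paper is strengthened; no side is taken on [IUTchIII] Cor. 3.12.
-/

namespace Literature.AlgebraicGeometry.Frobenioids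

namespace PreFrobenioid

open CategoryTheory

universe w v v' u u'

variable {D : Type u} [Category.{v} D] {Φ : Dᵒᵖ ⥤ CommMonCat.{w}}
  {C : Type u'} [Category.{v'} C] (F : C ⥤ ElemFrobenioid Φ)

/-- **Theorem 5.1 (iv)**, first clause, PROVED: for a Frobenioid of isotropic and unit-trivial type,
"any skeletal subcategory `P ⊆ (C^Fr-tr)^pl-bk` determines a base-section of `C`".
[cite: MochizukiFrdI2008, Thm. 5.1 (iv) p.97] -/
theorem thm51iv_baseSection : Thm51iv_baseSection F :=
  thm51iv_baseSection_of_thm51iii F (thm51iii_iso_of_baseIso_of_thm51i F (thm51i_holds F))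
    (thm51iii_frobeniusTrivial_isAutAmple_of_thm51i F (thm51i_holds F))

/-- `Thm51iv_baseSection` holds for all parameters — `_holds` alias of `thm51iv_baseSection` above
(appended 2026-08-28, D-0026 bookkeeping: the proof term is the existing theorem of this file;
no statement, definition or attribute is edited; no new named fact).
[cite: MochizukiFrdI2008, Thm. 5.1 (iv) p.97] -/
theorem Thm51iv_baseSection_holds : Thm51iv_baseSection F :=
  thm51iv_baseSection F

/-- **Theorem 5.1 (iv)**, "Moreover" (Def. 2.7 (iii) half), PROVED: a Frobenioid of isotropic and
unit-trivial type is of pre-model type. [cite: MochizukiFrdI2008, Thm. 5.1 (iv) p.97] -/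
theorem thm51iv_preModel : Thm51iv_preModel F :=
  thm51iv_preModel_of_thm51iii F (thm51iii_iso_of_baseIso_of_thm51i F (thm51i_holds F))
    (thm51iii_frobeniusTrivial_isAutAmple_of_thm51i F (thm51i_holds F))

/-- `Thm51iv_preModel` holds for all parameters — `_holds` alias of `thm51iv_preModel` above
(appended 2026-08-28, D-0026 bookkeeping: the proof term is the existing theorem of this file;
no statement, definition or attribute is edited; no new named fact).
[cite: MochizukiFrdI2008, Thm. 5.1 (iv) p.97] -/
theorem Thm51iv_preModel_holds : Thm51iv_preModel F :=
  thm51iv_preModel F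

end PreFrobenioid

end Literature.AlgebraicGeometry.Frobenioids
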